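import Literature.NumberTheory.DiophantineGeometry.LocalReductionMinimalityProofs
import Literature.NumberTheory.DiophantineGeometry.LocalReductionFiniteBadPlacesProofs
import Literature.NumberTheory.DiophantineGeometry.LocalReductionHasMultiplicativeReductionAtProofs
import Literature.NumberTheory.EllipticCurves.Rank1Residual.X11RankOneCertificates.Minimality
import Literature.NumberTheory.EllipticCurves.GlobalMinimalModel
import Literature.NumberTheory.EllipticCurves.NeronLocalHeightCompletion
import Literature.NumberTheory.EllipticCurves.ComplexMultiplicationTwistIsogenyProofs
import Mathlib.NumberTheory.RamificationInertia.Valuation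
import Mathlib.NumberTheory.RamificationInertia.Basic
import HarnessLib

/-!
# Global minimality of an integer Weierstrass model over a number field of small degree
# (Silverman, *AEC* VII.1 Remark 1.1 at every place of `K`, VIII.8)

Theorems only (no definition, no named fact, no instance). For an INTEGER Weierstrass equation
`W₀ = [a₁, a₂, a₃, a₄, a₆]`, `aᵢ ∈ ℤ`, and a number field `K` of degree `n = [K : ℚ]`:

* `exp_neg_mul_le_valuation_intCast` — at every finite place `w` of `K`, an integer `m ≠ 0` with
  `q^{k+1} ∤ m` for every rational prime `q` has `w`-adic valuation `≥ exp(−n·k)`: `ord_w(m) =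
  e(w | q)·ord_q(m) ≤ [K : ℚ]·k` (Mathlib: `IsDedekindDomain.HeightOneSpectrum.valuation_liesOver`,
  `Ideal.ramificationIdx_le_finrank`; the tree's `Rat.HeightOneSpectrum.valuation_eq_exp_neg_padicValRat`).
* **`isGloballyMinimal_baseChange_int_of_finrank_mul_lt_twelve`** — if `q^{k+1} ∤ Δ(W₀)` for every
  prime `q` and `[K : ℚ]·k < 12`, then `W₀ ⊗ K` is a GLOBAL MINIMAL MODEL over `K`: it is
  `𝓞_K`-integral, and at every place `ord_w Δ ≤ [K : ℚ]·k < 12`, so it is minimal at `w` (Silverman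
  VII.1 Rem. 1.1, the tree's `isMinimalAt_of_lt_valuation_Δ_holds`), hence globally minimal (VIII.8,
  the tree's `IsGloballyMinimal` = integral + minimal at every finite place). The `c₄` twin
  `isGloballyMinimal_baseChange_int_of_finrank_mul_lt_four` (`q^{k+1} ∤ c₄`, `[K:ℚ]·k < 4`).
* **`cm7_baseChange_isGloballyMinimal`** — the curve `X₀(49) = 49a1 = cm7 = [1, −1, 0, −2, −1]`
  (`Δ = −7³`, so `q⁴ ∤ Δ` for every `q`) stays globally minimal over EVERY number field of degree
  `≤ 3`, in particular over every quadratic field (`K = ℚ(√−7)`, `ℚ(√−q)`, …) — the standing instance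
  hypothesis `[(cm7.baseChange K).IsGloballyMinimal]` of the `K`-height uniqueness theorems
  (`existsUnique_isCanonicalSqK_two`, `PAdicHeightDataK.isCanonicalSq_unique`) discharged by a kernel
  theorem (cell `bsd-goldfeld`, referee watch 11 of `REF-P2-AUDIT-G46.md`).

Cell `bsd-goldfeld`, typer seat `bsd-goldfeld-ty` (g10); support for item
`stmt-BirchSwinnertonDyer-19141` (the `K = ℚ(√−7)` side of the `p = 2` height receptacle). HONEST
FRAMING: elementary; nothing about BSD is advanced here.

References: J. H. Silverman, *The Arithmetic of Elliptic Curves* (2009), VII.1 Remark 1.1, VIII.8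
[SilvermanAEC2009]; J. Neukirch, *Algebraic Number Theory* (1999), Ch. I (8.2) (fundamental identity
`∑ eᵢfᵢ = n`) [NeukirchANT1999]; J. E. Cremona, *Algorithms for Modular Elliptic Curves* (1997), Table 1
(curve 49a1) [Cremona1997].
-/

set_option autoImplicit false

noncomputable section

open scoped Classical

open IsDedekindDomain NumberField WeierstrassCurve

namespace Literature.NumberTheory.EllipticCurves

/-! ## §1. The valuation of a rational integer at a finite place of a number field -/

section Valuation

variable (K : Type) [Field K] [NumberField K]

/-- **`ord_w(m) ≤ [K : ℚ]·k` for an integer `m` with `q^{k+1} ∤ m` for all primes `q`**: at a finite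
place `w` of `K` over the rational prime `q`, `|m|_w = |m|_q^{e(w|q)}` (Mathlib `valuation_liesOver`)
with `e(w|q) ≤ [K : ℚ]` (the fundamental identity, `Ideal.ramificationIdx_le_finrank`) and
`|m|_q = q^{−ord_q m}`, `ord_q m ≤ k`. In `ℤᵐ⁰`: `exp(−[K:ℚ]·k) ≤ w(m)`.
[cite: NeukirchANT1999, Ch. I Prop. (8.2)] -/
theorem exp_neg_mul_le_valuation_intCast (w : HeightOneSpectrum (𝓞 K)) {m : ℤ}
    (k : ℕ) (h : ∀ q : ℕ, q.Prime → ¬ (q : ℤ) ^ (k + 1) ∣ m) :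
    WithZero.exp (-((Module.finrank ℚ K * k : ℕ) : ℤ)) ≤ w.valuation K (m : K) := by
  have hm : m ≠ 0 := fun h0 => h 2 Nat.prime_two (by rw [h0]; exact dvd_zero _)
  -- the place `v` of `ℤ` under `w`
  haveI := w.isMaximal
  haveI : (w.asIdeal.under ℤ).IsMaximal := Ideal.IsMaximal.under _ _
  have hv0 : w.asIdeal.under ℤ ≠ ⊥ := mt Ideal.eq_bot_of_comap_eq_bot w.ne_bot
  let v : HeightOneSpectrum ℤ := ⟨w.asIdeal.under ℤ, Ideal.IsMaximal.isPrime inferInstance, hv0⟩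
  haveI : w.asIdeal.LiesOver v.asIdeal := ⟨rfl⟩
  haveI := v.isMaximal
  -- `w(m) = v(m)^e`, `e ≤ [K : ℚ]`
  have hlies := IsDedekindDomain.HeightOneSpectrum.valuation_liesOver (L := K) v w (m : ℚ)
  have he : v.asIdeal.ramificationIdx' w.asIdeal ≤ Module.finrank ℚ K :=
    Ideal.ramificationIdx_le_finrank (𝓞 K) ℚ K w.asIdeal (p := v.asIdeal)
  -- `v(m) = exp(−ord_q m)` with `ord_q m ≤ k`
  set q : ℕ := Rat.HeightOneSpectrum.natGenerator v with hqdef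
  have hq : q.Prime := Rat.HeightOneSpectrum.prime_natGenerator v
  haveI : Fact q.Prime := ⟨hq⟩
  have hvm : v.valuation ℚ (m : ℚ) = WithZero.exp (-(padicValInt q m : ℤ)) := by
    rw [Rat.HeightOneSpectrum.valuation_eq_exp_neg_padicValRat v (by exact_mod_cast hm),
      ← hqdef, padicValRat.of_int]
  have hord : padicValInt q m ≤ k := by
    by_contra hlt
    refine h q hq ((padicValInt_dvd_iff (k + 1) m).mpr (Or.inr ?_))
    omega
  -- assemble
  have hmap : algebraMap ℚ K (m : ℚ) = (m : K) := map_intCast _ m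
  rw [← hmap, ← hlies, hvm, ← WithZero.exp_nsmul, WithZero.exp_le_exp, nsmul_eq_mul]
  push_cast
  have he0 : (0 : ℤ) ≤ (v.asIdeal.ramificationIdx' w.asIdeal : ℤ) := by positivity
  have hk0 : (0 : ℤ) ≤ (k : ℤ) := by positivity
  have ho0 : (0 : ℤ) ≤ (padicValInt q m : ℤ) := by positivity
  have he' : (v.asIdeal.ramificationIdx' w.asIdeal : ℤ) ≤ (Module.finrank ℚ K : ℤ) := by
    exact_mod_cast he
  have hord' : (padicValInt q m : ℤ) ≤ (k : ℤ) := by exact_mod_cast hord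
  nlinarith [he', hord', he0, hk0, ho0]

/-- Every rational integer has `w`-valuation `≤ 1` at a finite place `w` of `K`. [folklore] -/
private theorem valuation_intCast_le_one (w : HeightOneSpectrum (𝓞 K)) (m : ℤ) :
    w.valuation K (m : K) ≤ 1 := by
  have h : (m : K) = algebraMap (𝓞 K) K (m : 𝓞 K) := by simp
  rw [h]
  exact w.valuation_le_one _

end Valuation

/-! ## §2. Integer models over a number field of small degree are globally minimal -/

section Minimality

variable (W₀ : WeierstrassCurve ℤ) (K : Type) [Field K] [NumberField K]

omit [NumberField K] in
/-- An integer equation base-changed to a number field is `𝓞_K`-integral. [folklore] -/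
private theorem isIntegral_baseChange_int : (W₀.baseChange K).IsIntegral (𝓞 K) :=
  isIntegral_of_exists_lift (𝓞 K) ⟨(W₀.a₁ : 𝓞 K), by simp [baseChange]⟩
    ⟨(W₀.a₂ : 𝓞 K), by simp [baseChange]⟩ ⟨(W₀.a₃ : 𝓞 K), by simp [baseChange]⟩
    ⟨(W₀.a₄ : 𝓞 K), by simp [baseChange]⟩ ⟨(W₀.a₆ : 𝓞 K), by simp [baseChange]⟩

/-- … and `w`-integral at every finite place `w`. [folklore] -/
private theorem isIntegralAt_baseChange_int (w : HeightOneSpectrum (𝓞 K)) :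
    (W₀.baseChange K).IsIntegralAt w := by
  refine isIntegralAt_of_valuation_le_one w (W₀.baseChange K) ?_ ?_ ?_ ?_ ?_ <;>
    simp only [baseChange, map_a₁, map_a₂, map_a₃, map_a₄, map_a₆, algebraMap_int_eq,
      Int.coe_castRingHom] <;>
    exact valuation_intCast_le_one K w _

/-- **Silverman's `Δ`-criterion over a number field of small degree.** Let `W₀` be an integer
Weierstrass equation with `q^{k+1} ∤ Δ(W₀)` for every prime `q`, and `K` a number field with
`[K : ℚ]·k < 12`. Then `W₀ ⊗ K` is a global minimal model over `K`: at every finite place `w`,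
`ord_w Δ ≤ e(w|q)·ord_q Δ ≤ [K : ℚ]·k < 12`, so the integral equation is minimal at `w` (AEC VII.1
Rem. 1.1), and an equation integral and minimal at every place is globally minimal (AEC VIII.8).
[cite: SilvermanAEC2009, VII.1 Remark 1.1 and VIII.8] -/
theorem isGloballyMinimal_baseChange_int_of_finrank_mul_lt_twelve (k : ℕ)
    (hΔ : ∀ q : ℕ, q.Prime → ¬ (q : ℤ) ^ (k + 1) ∣ W₀.Δ) (hk : Module.finrank ℚ K * k < 12) :
    (W₀.baseChange K).IsGloballyMinimal where
  isIntegral := isIntegral_baseChange_int W₀ K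
  isMinimal w := by
    refine isMinimalAt_of_lt_valuation_Δ_holds (isIntegralAt_baseChange_int W₀ K w) ?_
    have hΔK : (W₀.baseChange K).Δ = ((W₀.Δ : ℤ) : K) := by
      simp [baseChange, map_Δ]
    rw [hΔK]
    refine lt_of_lt_of_le ?_ (exp_neg_mul_le_valuation_intCast K w k hΔ)
    rw [WithZero.exp_lt_exp]
    omega

/-- **The `c₄` twin**: `q^{k+1} ∤ c₄(W₀)` for every prime `q` and `[K : ℚ]·k < 4` ⟹ `W₀ ⊗ K` is
globally minimal (AEC VII.1 Rem. 1.1: integral with `ord_w c₄ < 4` ⟹ minimal at `w`).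
[cite: SilvermanAEC2009, VII.1 Remark 1.1 and VIII.8] -/
theorem isGloballyMinimal_baseChange_int_of_finrank_mul_lt_four (k : ℕ)
    (hc₄ : ∀ q : ℕ, q.Prime → ¬ (q : ℤ) ^ (k + 1) ∣ W₀.c₄) (hk : Module.finrank ℚ K * k < 4) :
    (W₀.baseChange K).IsGloballyMinimal where
  isIntegral := isIntegral_baseChange_int W₀ K
  isMinimal w := by
    refine isMinimalAt_of_lt_valuation_c₄ (isIntegralAt_baseChange_int W₀ K w) ?_
    have hcK : (W₀.baseChange K).c₄ = ((W₀.c₄ : ℤ) : K) := by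
      simp [baseChange, map_c₄]
    rw [hcK]
    refine lt_of_lt_of_le ?_ (exp_neg_mul_le_valuation_intCast K w k hc₄)
    rw [WithZero.exp_lt_exp]
    omega

end Minimality

/-! ## §3. `X₀(49) = 49a1` stays globally minimal over every number field of degree `≤ 3` -/

section X049

/-- `cm7 ⊗ K` is the base change of the integer equation `[1, −1, 0, −2, −1]`. [folklore] -/
private theorem cm7_baseChange_eq (K : Type) [Field K] [NumberField K] :
    cm7.baseChange K = (⟨1, -1, 0, -2, -1⟩ : WeierstrassCurve ℤ).baseChange K := by
  ext <;> simp [baseChange, WeierstrassCurve.map]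

/-- **`X₀(49) = 49a1 = [1, −1, 0, −2, −1]` is a global minimal model over every number field `K` with
`[K : ℚ] ≤ 3`** — in particular over every quadratic field (`ℚ(√−7)`, the CM field; `ℚ(√−q)`): its
discriminant is `Δ = −343 = −7³`, so `q⁴ ∤ Δ` for every prime `q` and `[K : ℚ]·3 ≤ 9 < 12`
(`isGloballyMinimal_baseChange_int_of_finrank_mul_lt_twelve`). Discharges the standing instance
hypothesis `[(cm7.baseChange K).IsGloballyMinimal]` of the `K`-height uniqueness theorems.
[cite: Cremona1997, Table 1 (curve 49a1: Δ = −343)] [cite: SilvermanAEC2009, VII.1 Remark 1.1 and VIII.8] -/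
theorem cm7_baseChange_isGloballyMinimal (K : Type) [Field K] [NumberField K]
    (hK : Module.finrank ℚ K ≤ 3) : (cm7.baseChange K).IsGloballyMinimal := by
  rw [cm7_baseChange_eq K]
  refine isGloballyMinimal_baseChange_int_of_finrank_mul_lt_twelve _ K 3 (fun q hq hdvd => ?_)
    (by omega)
  have hD : (⟨1, -1, 0, -2, -1⟩ : WeierstrassCurve ℤ).Δ = -343 := by
    simp only [WeierstrassCurve.Δ, WeierstrassCurve.b₂, WeierstrassCurve.b₄, WeierstrassCurve.b₆,
      WeierstrassCurve.b₈]
    norm_num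
  rw [hD, dvd_neg] at hdvd
  have h1 : q ^ 4 ∣ 343 := by exact_mod_cast Int.natAbs_dvd_natAbs.mpr hdvd
  have h2 : q ^ 4 ≤ 343 := Nat.le_of_dvd (by norm_num) h1
  have hq5 : q < 5 := by
    by_contra h5
    have : 5 ^ 4 ≤ q ^ 4 := Nat.pow_le_pow_left (by omega) 4
    omega
  interval_cases q <;> simp_all (config := {decide := true})

end X049

end Literature.NumberTheory.EllipticCurves

end
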